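import Summits.HodgeConjecture.HodgeConjecture.Cruxes.AlgebraicOrEnveloped.IdeatorFiveSketch
import Literature.AlgebraicGeometry.HodgeTheory.LefschetzOneOne

/-!
# STRATEGY-CENSUS — typed companions (crux-strategist wall-breaker, gen 1, 2026-08-17)

Crux `stmt-HodgeConjecture-14943` = `EndoscopicMiddleDegree.AlgebraicOrEnveloped`.
This file types the signatures quoted in `STRATEGY-CENSUS.md` (§Transfer, §Strengthen, §Decomposition)
over the vocabulary of the registered bet (`IsCore`, `Bet`, `CoreHodgeBarren` of `IdeatorFiveSketch`),
and kernel-checks the two trivial glues. Nothing here is a line: every open statement below is the bet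
restricted or strengthened, and the census explains why each switch has no teeth.

* §Transfer  — `BetSurface` (the bet's shape one dimension down, `m = 0`) follows from Lefschetz (1,1)
  ALONE (`betSurface_of_lefschetz`): the solved sibling's version of exactly this step never looks at the
  core; the transfer breaks at the binder `1 ≤ m` (no Lefschetz theorem in degree `2n ≥ 4`).
* §Strengthen — `CoreHeckeSimple` (S⁺: no rational, Hodge-type-preserving idempotent commuting with the
  Hecke algebra splits a core).
* §Decomposition — `BetNarrow` / `BetWide` (cores whose fixed vectors realise ≤ 3 Hodge types, resp. more),
  glue `bet_of_narrow_of_wide`, `algebraicOrEnveloped_of_narrow_of_wide` (via the landed p119631).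
-/

noncomputable section

set_option linter.dupNamespace false

namespace Summit.HodgeConjecture.HodgeConjecture.Cruxes.AlgebraicOrEnveloped.StrategyCensus

open CategoryTheory MonoidalCategory CartesianMonoidalCategory
open Literature.AlgebraicGeometry.Motives (SchemeOver ComplexPoints IsSmoothProjective)
open Literature.AlgebraicGeometry.HodgeTheory
open Literature.AlgebraicGeometry.ShimuraVarieties
open Literature.AlgebraicTopology.SingularHomology
open Summit.HodgeConjecture.HodgeConjecture.Theses.EndoscopicMiddleDegree (AlgebraicOrEnveloped MiddleDegreeStep)
open Summit.HodgeConjecture.HodgeConjecture.Cruxes.MiddleThetaSpan.ConjugateDimensionSieve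
  (IsPrimitiveCentralIdempotent)
open Summit.HodgeConjecture.HodgeConjecture.Cruxes.AlgebraicOrEnveloped.CycleBlindCores
  (heckeAlg IsCore Bet CoreHodgeBarren AlgCoreZero bet_of_coreHodgeBarren)
open Summit.HodgeConjecture.HodgeConjecture.Theorems.CoreSplittingLadder (algebraicOrEnveloped_of_bet)

variable {m : ℕ} {X : SchemeOver ℂ}

/-! ## §Transfer — the Lefschetz sibling: one dimension down the bet is Lefschetz (1,1), verbatim -/

/-- The bet's shape at `m = 0` (compact arithmetic 2-ball quotients, degree 2): a Hecke core maps
rational Hodge `(1,1)`-classes into `algebraicClasses X 1`. -/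
def BetSurface : Prop :=
  ∀ (X : SchemeOver ℂ) (D : UnitaryBallQuotientDatum (2 * (0 + 1)) X),
    ∀ ε : Module.End ℂ (complexBetti X (2 * (0 + 1))), IsCore D ε →
      ∀ e : complexBetti X (2 * (0 + 1)), IsRationalClass e →
        IsOfHodgeType (2 * (0 + 1)) X (2 * (0 + 1)) (0 + 1) (0 + 1) e →
        ε e ∈ algebraicClasses X (0 + 1)

/-- **Transfer check.** Lefschetz (1,1) (the tree's named fact `lefschetzOneOne_rational`) proves the
surface bet WITHOUT using that `ε` is a core: `ε e` is rational (cores preserve rationality) and of type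
`(1,1)` (cores preserve Hodge types), hence algebraic. The sibling's engine is blind to the block
structure; what fails one dimension up is the engine itself (no Lefschetz theorem in degree `≥ 4`).
[cite: VoisinHodgeI2002, Thm. 11.30] -/
theorem betSurface_of_lefschetz (hL : lefschetzOneOne_rational) : BetSurface := by
  intro X D ε hε e he hH
  have hrat : IsRationalClass (ε e) := hε.2.2.2.1 e he
  have hhodge : IsOfHodgeType (2 * (0 + 1)) X (2 * (0 + 1)) (0 + 1) (0 + 1) (ε e) :=
    hε.2.2.2.2.1 _ _ e hH
  exact hL D.isSmoothProjective (ε e) hrat hhodge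

/-! ## §Strengthen — S⁺ = Hecke-simplicity of cores -/

/-- **S⁺ (`CoreHeckeSimple`).** No rational, Hodge-type-preserving idempotent of `H²ⁿ(X(ℂ); ℂ)` commuting
with the Hecke algebra splits a core: `f ∘ ε ∈ {0, ε}`. Paper: S⁺ ⟹ `CoreHodgeBarren` (the Hecke span of a
rational Hodge class in a core is a `ℚ`-sub-Hodge-structure of pure type `(n,n)`, anisotropic by
Hodge–Riemann, so its orthogonal projector is such an `f` with `0 ≠ f ∘ ε ≠ ε` whenever the core is
impure). S⁺ is "End_{Hecke-HS}(core) has no idempotents" — a Mumford–Tate / period statement with no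
induction parameter (X is rigid; level change does not relate periods), strictly harder than the bet. -/
def CoreHeckeSimple : Prop :=
  ∀ (m : ℕ) (X : SchemeOver ℂ) (D : UnitaryBallQuotientDatum (2 * (m + 1)) X), 1 ≤ m → m ≤ 2 →
    ∀ ε : Module.End ℂ (complexBetti X (2 * (m + 1))), IsCore D ε →
      ∀ f : Module.End ℂ (complexBetti X (2 * (m + 1))), f * f = f →
        (∀ T ∈ heckeAlg D, T * f = f * T) →
        (∀ β, IsRationalClass β → IsRationalClass (f β)) →
        (∀ (p q : ℕ) (x : complexBetti X (2 * (m + 1))),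
            IsOfHodgeType (2 * (m + 1)) X (2 * (m + 1)) p q x →
            IsOfHodgeType (2 * (m + 1)) X (2 * (m + 1)) p q (f x)) →
        f * ε = 0 ∨ f * ε = ε

/-! ## §Decomposition — narrow / wide cores (typed; glue trivial; the WIDE piece is the whole crux) -/

/-- A core idempotent `ε` is NARROW if its non-zero fixed vectors of pure Hodge type realise at most
three types `(p,q)` (paper: hosts `Ψ₂ ∋ 0`, `Ψ₃ ∋ 0` at `m = 1` — the only shapes with an abelian /
Lefschetz avatar modulo an Ichino–Prasanna-type isomorphism of Hodge structures). -/
def IsNarrow (ε : Module.End ℂ (complexBetti X (2 * (m + 1)))) : Prop :=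
  ∃ S : Finset (ℕ × ℕ), S.card ≤ 3 ∧
    ∀ (p q : ℕ) (x : complexBetti X (2 * (m + 1))),
      IsOfHodgeType (2 * (m + 1)) X (2 * (m + 1)) p q x → ε x = x → x ≠ 0 → (p, q) ∈ S

/-- The bet on NARROW cores. -/
def BetNarrow : Prop :=
  ∀ (m : ℕ) (X : SchemeOver ℂ) (D : UnitaryBallQuotientDatum (2 * (m + 1)) X), 1 ≤ m → m ≤ 2 →
    (∀ a : complexBetti X (2 * m), IsRationalClass a →
      IsOfHodgeType (2 * (m + 1)) X (2 * m) m m a → a ∈ algebraicClasses X m) →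
    ∀ ε : Module.End ℂ (complexBetti X (2 * (m + 1))), IsCore D ε → IsNarrow ε →
      ∀ e : complexBetti X (2 * (m + 1)), IsRationalClass e →
        IsOfHodgeType (2 * (m + 1)) X (2 * (m + 1)) (m + 1) (m + 1) e →
        ε e ∈ algebraicClasses X (m + 1)

/-- The bet on WIDE cores (≥ 4 Hodge types among the fixed vectors; paper: stable `Ψ_{2n+1}`,
`Ψ₄ ∋ 0 ⊞ χ`, … — no avatar of any kind in print). -/
def BetWide : Prop :=
  ∀ (m : ℕ) (X : SchemeOver ℂ) (D : UnitaryBallQuotientDatum (2 * (m + 1)) X), 1 ≤ m → m ≤ 2 →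
    (∀ a : complexBetti X (2 * m), IsRationalClass a →
      IsOfHodgeType (2 * (m + 1)) X (2 * m) m m a → a ∈ algebraicClasses X m) →
    ∀ ε : Module.End ℂ (complexBetti X (2 * (m + 1))), IsCore D ε → ¬ IsNarrow ε →
      ∀ e : complexBetti X (2 * (m + 1)), IsRationalClass e →
        IsOfHodgeType (2 * (m + 1)) X (2 * (m + 1)) (m + 1) (m + 1) e →
        ε e ∈ algebraicClasses X (m + 1)

/-- Glue (exhaustive case split): narrow ∧ wide ⟹ the bet (registered stub text, unbundled). -/
theorem bet_of_narrow_of_wide (hN : BetNarrow) (hW : BetWide) : Bet := by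
  intro m X D hm1 hm2 hlow ε h1 h2 h3 h4 h5 h6 h7 h8 e he hH
  by_cases hn : IsNarrow ε
  · exact hN m X D hm1 hm2 hlow ε ⟨h1, h2, h3, h4, h5, h6, h7, h8⟩ hn e he hH
  · exact hW m X D hm1 hm2 hlow ε ⟨h1, h2, h3, h4, h5, h6, h7, h8⟩ hn e he hH

/-- … hence the crux BY NAME (through the landed `algebraicOrEnveloped_of_bet`, p119631). -/
theorem algebraicOrEnveloped_of_narrow_of_wide (hN : BetNarrow) (hW : BetWide) : AlgebraicOrEnveloped :=
  algebraicOrEnveloped_of_bet (bet_of_narrow_of_wide hN hW)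

/-- Calibration: each piece is implied by the bet (so by the target, p117875, and by HC). -/
theorem narrow_and_wide_of_bet (h : Bet) : BetNarrow ∧ BetWide := by
  refine ⟨?_, ?_⟩
  · intro m X D hm1 hm2 hlow ε hε _ e he hH
    obtain ⟨h1, h2, h3, h4, h5, h6, h7, h8⟩ := hε
    exact h m X D hm1 hm2 hlow ε h1 h2 h3 h4 h5 h6 h7 h8 e he hH
  · intro m X D hm1 hm2 hlow ε hε _ e he hH
    obtain ⟨h1, h2, h3, h4, h5, h6, h7, h8⟩ := hε
    exact h m X D hm1 hm2 hlow ε h1 h2 h3 h4 h5 h6 h7 h8 e he hH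

/-- `CoreHodgeBarren` (C⁺ of cycle-blind-cores) implies both pieces with `ε e = 0`. -/
theorem narrow_and_wide_of_coreHodgeBarren (h : CoreHodgeBarren) : BetNarrow ∧ BetWide :=
  narrow_and_wide_of_bet (bet_of_coreHodgeBarren h)

end Summit.HodgeConjecture.HodgeConjecture.Cruxes.AlgebraicOrEnveloped.StrategyCensus

end
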